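import Summits.HubbardSuperconductivity.HubbardSuperconductivity.Theorems.AposterioriCapRgSeededBrokenRegimeBoseFermiPinnedGaussConvFlow
import Summits.HubbardSuperconductivity.HubbardSuperconductivity.Theorems.AposterioriCapRgSeededBrokenRegimeBoseFermiPinnedSeedWardAction
import Summits.HubbardSuperconductivity.HubbardSuperconductivity.Theorems.AposterioriCapRgSeededBrokenRegimeBoseFermiPinnedWeakProductRule
import Summits.HubbardSuperconductivity.HubbardSuperconductivity.Theorems.AposterioriCapRgSeededBrokenRegimeBoseFermiPinnedSeedCovDifferentiable

/-!
# Polchinski's flow equation for the Wilsonian effective action, and the SEED FLOW of the countertermed Hubbard torus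
# (crux `SeededBrokenRegimeBoseFermiPinned` = stmt-HubbardSuperconductivity-14047, route AposterioriCapRg)

Support file (`--supports stmt-HubbardSuperconductivity-14047`).  The landed S11 `stub_gaussConvFlow` is Salmhofer's RG
differential equation for the Gaussian CONVOLUTION (the effective Boltzmann factor), coefficientwise.  This file upgrades it to
the normalised EFFECTIVE ACTION `𝒢_s = effAction (C s) V` — Polchinski's / Salmhofer's flow equation with its quadratic term —
and instantiates it on the seed strength `h` of the countertermed Hubbard torus, which is exactly what the line's STEP obligation
(lowering the Koma–Tasaki seed h-uniformly) integrates.  The Grassmann algebra carries no norm, so curves are differentiated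
"weakly", through every `ℂ`-linear functional `φ` (the idiom of the S11 file); in finite dimension this is full differentiability.

* `eq_of_forall_linearMap_apply_eq` — linear functionals separate points (finite monomial basis).
* `hasDerivAt_apply_effBoltzmann`, `hasDerivAt_effPartitionFn` — the flow of `B_s = μ_{C_s} ⋆ e^{-V}` and of `Z_s = constPart B_s`
  along ANY entrywise differentiable covariance path: `∂_s φ(B_s) = φ(Δ_{Ċ} B_t)`.
* `exists_hasDerivAt_apply_effAction` — `𝒢_s` is weakly differentiable at `t` whenever `Z_t ≠ 0` (near `t` it is a FIXED polynomial
  in the weakly differentiable curve `Z_s⁻¹ • B_s - 1`; weak product/power rules `hasDerivAt_apply_mul/_pow_of_commute`, landed).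
* **`hasDerivAt_apply_effAction`** — POLCHINSKI'S EQUATION for the normalised effective action of an EVEN interaction:
  `∂_s 𝒢_s |_{s=t} = Δ_{Ċ} 𝒢_t - ½ Σ_{X,Y} Ċ(X,Y) ∂_X𝒢_t ∂_Y𝒢_t + (Ż_t/Z_t) · 1`
  (weakly; `Ċ = C'`, `Ż_t = constPart (Δ_{Ċ} B_t)`), obtained WITHOUT differentiating the logarithm: differentiate the identity
  `B_s = Z_s • e^{-𝒢_s}` weakly, compare with the Boltzmann flow by uniqueness of derivatives and separation, and solve with the
  landed `Δ_C e^{-g} = e^{-g}(-Δ_C g + ½ Σ C ∂g ∂g)` (`grassmannLaplacian_grassmannExp_neg_of_mem_evenOdd_zero`).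
* **`seedFlow_hubbardEffectiveActionCT`** — THE SEED FLOW EQUATION: for `β, Λ > 0` and `Z^K_{Λ,h} ≠ 0`, the map
  `h ↦ 𝒢^K_{Λ,h} = hubbardEffectiveActionCT L M β U μ h K Λ` satisfies Polchinski's equation in the seed strength with the
  entrywise `h`-derivative of the seeded CT covariance above scale (`hasDerivAt_hubbardCovAboveCT_seed`, landed) — every finite
  `L ≥ 1`, `M`, frame `K`, scale `Λ`.

Sources: M. Salmhofer, *Renormalization* (1999), Prop. 4.3, (4.89)–(4.91) [`Salmhofer1999`]; J. Polchinski, Nucl. Phys. B 231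
(1984) 269, (27); the finite-dimensional Grassmann version here is folklore bookkeeping over the tree's `Δ_C` calculus.
-/

set_option linter.dupNamespace false -- `Summit.<S>.<S>` doubles the summit name (tree convention)

namespace Summit.HubbardSuperconductivity.HubbardSuperconductivity.Theorems.AposterioriCapRgSeededBrokenRegimeBoseFermiPinned

open Literature.MathematicalPhysics.QuantumLattice Literature.Probability.LatticeModels GrassmannAlgebra

/-! ### Separation by functionals; the flow of the Boltzmann factor and of the partition function -/

/-- **Linear functionals separate the points of the Grassmann algebra** (finite monomial basis). [folklore] -/
theorem eq_of_forall_linearMap_apply_eq :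
    ∀ {Γ : Type} [Fintype Γ] (a b : GrassmannAlgebra ℂ Γ), (∀ φ : GrassmannAlgebra ℂ Γ →ₗ[ℂ] ℂ, φ a = φ b) → a = b := by
  intro Γ _ a b h
  classical
  letI : LinearOrder Γ := LinearOrder.lift' (Fintype.equivFin Γ) (Fintype.equivFin Γ).injective
  exact (grassmannBasis ℂ Γ).ext_elem fun s => h ((grassmannBasis ℂ Γ).coord s)

/-- **The flow of the effective Boltzmann factor, functional-wise**: along an entrywise differentiable covariance path,
`∂_s φ(μ_{C_s} ⋆ e^{-V}) = φ(Δ_{Ċ} (μ_{C_t} ⋆ e^{-V}))` for every linear functional `φ` (S11 `hasDerivAt_apply_gaussConv`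
transported by the semigroup property, as in `stub_gaussConvFlow`). [cite: Salmhofer1999, Prop. 4.3 (4.89)] -/
theorem hasDerivAt_apply_effBoltzmann :
    ∀ {Γ : Type} [Fintype Γ] [DecidableEq Γ] (C : ℝ → Matrix Γ Γ ℂ) (C' : Matrix Γ Γ ℂ) (t : ℝ),
      (∀ X Y, HasDerivAt (fun s => C s X Y) (C' X Y) t) → ∀ (V : GrassmannAlgebra ℂ Γ) (φ : GrassmannAlgebra ℂ Γ →ₗ[ℂ] ℂ),
        HasDerivAt (fun s => φ (effBoltzmann ℂ (C s) V)) (φ (grassmannLaplacian ℂ C' (effBoltzmann ℂ (C t) V))) t := by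
  intro Γ _ _ C C' t hC V φ
  have hD : ∀ X Y, HasDerivAt (fun s => (C s - C t) X Y) (C' X Y) t := fun X Y => (hC X Y).sub_const (C t X Y)
  have key := hasDerivAt_apply_gaussConv (fun s => C s - C t) C' t hD (sub_self _) (effBoltzmann ℂ (C t) V) φ
  have hfun : (fun s => φ (effBoltzmann ℂ (C s) V)) = fun s => φ (gaussConv ℂ (C s - C t) (effBoltzmann ℂ (C t) V)) := by
    funext s
    rw [← effBoltzmann_add, sub_add_cancel]
  rw [hfun]
  exact key

/-- **The flow of the normalised partition function**: `∂_s Z_s = constPart (Δ_{Ċ} (μ_{C_t} ⋆ e^{-V}))`. [folklore] -/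
theorem hasDerivAt_effPartitionFn :
    ∀ {Γ : Type} [Fintype Γ] [DecidableEq Γ] (C : ℝ → Matrix Γ Γ ℂ) (C' : Matrix Γ Γ ℂ) (t : ℝ),
      (∀ X Y, HasDerivAt (fun s => C s X Y) (C' X Y) t) → ∀ (V : GrassmannAlgebra ℂ Γ),
        HasDerivAt (fun s => effPartitionFn ℂ (C s) V) (constPart ℂ (grassmannLaplacian ℂ C' (effBoltzmann ℂ (C t) V))) t := by
  intro Γ _ _ C C' t hC V
  exact hasDerivAt_apply_effBoltzmann C C' t hC V (constPart ℂ (Γ := Γ)).toLinearMap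

/-! ### Weak differentiability of the effective action, Polchinski's equation -/

/-- **The effective action is weakly differentiable along a differentiable covariance path** wherever the normalised partition
function does not vanish: there is `G₁` with `∂_s φ(𝒢_s)|_{s=t} = φ(G₁)` for every linear functional `φ` (near `t`, `𝒢_s` is a fixed
polynomial in the weakly differentiable even curve `Z_s⁻¹ • B_s - 1`). [folklore] -/
theorem exists_hasDerivAt_apply_effAction :
    ∀ {Γ : Type} [Fintype Γ] [DecidableEq Γ] (C : ℝ → Matrix Γ Γ ℂ) (C' : Matrix Γ Γ ℂ) (t : ℝ),
      (∀ X Y, HasDerivAt (fun s => C s X Y) (C' X Y) t) → ∀ {V : GrassmannAlgebra ℂ Γ}, V ∈ GrassmannAlgebra.evenOdd ℂ 0 →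
        effPartitionFn ℂ (C t) V ≠ 0 → ∃ G₁ : GrassmannAlgebra ℂ Γ,
          ∀ φ : GrassmannAlgebra ℂ Γ →ₗ[ℂ] ℂ, HasDerivAt (fun s => φ (effAction ℂ (C s) V)) (φ G₁) t := by
  intro Γ _ _ C C' t hC V hVe hZ
  -- the partition function and the Boltzmann factor along the path, and their (weak) derivatives
  set Z : ℝ → ℂ := fun s => effPartitionFn ℂ (C s) V with hZdef
  set B : ℝ → GrassmannAlgebra ℂ Γ := fun s => effBoltzmann ℂ (C s) V with hBdef
  have hZd : HasDerivAt Z (constPart ℂ (grassmannLaplacian ℂ C' (B t))) t := hasDerivAt_effPartitionFn C C' t hC V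
  have hBd : ∀ ψ : GrassmannAlgebra ℂ Γ →ₗ[ℂ] ℂ,
      HasDerivAt (fun s => ψ (B s)) (ψ (grassmannLaplacian ℂ C' (B t))) t :=
    fun ψ => hasDerivAt_apply_effBoltzmann C C' t hC V ψ
  have hZt : Z t ≠ 0 := hZ
  -- the curve `x_s = Z_s⁻¹ • B_s - 1` and its weak derivative `X₁`
  set x : ℝ → GrassmannAlgebra ℂ Γ := fun s => (Z s)⁻¹ • B s - 1 with hxdef
  set X₁ : GrassmannAlgebra ℂ Γ := (-constPart ℂ (grassmannLaplacian ℂ C' (B t)) / Z t ^ 2) • B t +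
    (Z t)⁻¹ • grassmannLaplacian ℂ C' (B t) with hX₁def
  have hxd : ∀ ψ : GrassmannAlgebra ℂ Γ →ₗ[ℂ] ℂ, HasDerivAt (fun s => ψ (x s)) (ψ X₁) t := by
    intro ψ
    have h1 := ((hZd.inv hZt).mul (hBd ψ)).sub_const (ψ 1)
    have hf : (fun s => ψ (x s)) = fun s => (Z⁻¹ * fun s => ψ (B s)) s - ψ 1 := by
      funext s
      simp only [hxdef, map_sub, map_smul, smul_eq_mul, Pi.mul_apply, Pi.inv_apply]
    rw [hf]
    refine h1.congr_deriv ?_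
    simp only [hX₁def, map_add, map_smul, smul_eq_mul, Pi.inv_apply]
  -- `x_t` is even, hence commutes with `X₁`
  have hBe : B t ∈ GrassmannAlgebra.evenOdd ℂ 0 := effBoltzmann_mem_evenOdd_zero (C t) hVe
  have hxe : x t ∈ GrassmannAlgebra.evenOdd ℂ 0 :=
    Submodule.sub_mem _ (Submodule.smul_mem _ _ hBe) (one_mem_evenOdd_zero ℂ)
  have hcomm : Commute (x t) X₁ := commute_of_mem_evenOdd_zero ℂ hxe X₁
  -- powers of `x`
  have hpow : ∀ (k : ℕ) (ψ : GrassmannAlgebra ℂ Γ →ₗ[ℂ] ℂ),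
      HasDerivAt (fun s => ψ (x s ^ k)) (ψ ((k : ℂ) • (x t ^ (k - 1) * X₁))) t := by
    intro k ψ
    cases k with
    | zero =>
      simp only [pow_zero, Nat.cast_zero, zero_smul, map_zero]
      exact hasDerivAt_const t (ψ 1)
    | succ n =>
      simpa using hasDerivAt_apply_pow_of_commute x X₁ t hxd hcomm n ψ
  -- near `t` the partition function does not vanish, and there the effective action is a FIXED polynomial in `x_s`
  set N := Fintype.card Γ with hN
  have hev : ∀ᶠ s in nhds t, Z s ≠ 0 := hZd.continuousAt.eventually_ne hZt
  have hpoly : ∀ s, Z s ≠ 0 → effAction ℂ (C s) V =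
      -∑ k ∈ Finset.range (N + 1), (((-1 : ℚ) ^ (k + 1)) / k) • x s ^ k := by
    intro s hs
    have hx0 : constPart ℂ (x s) = 0 := by
      simp only [hxdef, map_sub, map_smul, map_one, smul_eq_mul]
      change (Z s)⁻¹ * Z s - 1 = 0
      rw [inv_mul_cancel₀ hs, sub_self]
    have hnil : x s ^ (N + 1) = 0 := pow_card_succ_eq_zero_of_constPart_eq_zero ℂ hx0
    rw [effAction_def, Ring.inverse_eq_inv, grassmannLog1p_eq_sum ℂ hnil]
  -- the candidate weak derivative
  refine ⟨-∑ k ∈ Finset.range (N + 1), (((-1 : ℚ) ^ (k + 1)) / k) • ((k : ℂ) • (x t ^ (k - 1) * X₁)), fun φ => ?_⟩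
  have hF : HasDerivAt (fun s => φ (-∑ k ∈ Finset.range (N + 1), (((-1 : ℚ) ^ (k + 1)) / k) • x s ^ k))
      (φ (-∑ k ∈ Finset.range (N + 1), (((-1 : ℚ) ^ (k + 1)) / k) • ((k : ℂ) • (x t ^ (k - 1) * X₁)))) t := by
    have hrw : ∀ y : ℕ → GrassmannAlgebra ℂ Γ, φ (-∑ k ∈ Finset.range (N + 1), (((-1 : ℚ) ^ (k + 1)) / k) • y k) =
        -∑ k ∈ Finset.range (N + 1), (((((-1 : ℚ) ^ (k + 1)) / k : ℚ) : ℂ) * φ (y k)) := by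
      intro y
      rw [map_neg, map_sum]
      congr 1
      refine Finset.sum_congr rfl fun k _ => ?_
      rw [LinearMap.map_smul_of_tower, ← Rat.cast_smul_eq_qsmul ℂ, smul_eq_mul]
    rw [show (fun s => φ (-∑ k ∈ Finset.range (N + 1), (((-1 : ℚ) ^ (k + 1)) / k) • x s ^ k)) =
        fun s => -∑ k ∈ Finset.range (N + 1), (((((-1 : ℚ) ^ (k + 1)) / k : ℚ) : ℂ) * φ (x s ^ k)) from
      funext fun s => hrw fun k => x s ^ k, hrw]
    exact (HasDerivAt.fun_sum fun k _ => (hpow k φ).const_mul _).neg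
  exact hF.congr_of_eventuallyEq (hev.mono fun s hs => by simp only [hpoly s hs])

/-- **POLCHINSKI'S EQUATION for the normalised Wilsonian effective action** (Salmhofer 1999, Prop. 4.3, (4.89)–(4.91), in
the convention `constPart 𝒢 = 0`): along an entrywise differentiable covariance path `s ↦ C_s` with `Ċ_t = C'`, for an EVEN
interaction `V` with `Z_t ≠ 0`, the effective action `𝒢_s = effAction (C s) V` satisfies, weakly at `s = t`,
`∂_s 𝒢_s = Δ_{Ċ} 𝒢_t - ½ Σ_{X,Y} Ċ(X,Y) ∂_X𝒢_t ∂_Y𝒢_t + (Ż_t / Z_t) · 1`, `Ż_t = constPart (Δ_{Ċ} (μ_{C_t} ⋆ e^{-V}))`.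
[cite: Salmhofer1999, Prop. 4.3 (4.89)] -/
theorem hasDerivAt_apply_effAction :
    ∀ {Γ : Type} [Fintype Γ] [DecidableEq Γ] (C : ℝ → Matrix Γ Γ ℂ) (C' : Matrix Γ Γ ℂ) (t : ℝ),
      (∀ X Y, HasDerivAt (fun s => C s X Y) (C' X Y) t) → ∀ {V : GrassmannAlgebra ℂ Γ}, V ∈ GrassmannAlgebra.evenOdd ℂ 0 →
        effPartitionFn ℂ (C t) V ≠ 0 → ∀ φ : GrassmannAlgebra ℂ Γ →ₗ[ℂ] ℂ,
          HasDerivAt (fun s => φ (effAction ℂ (C s) V))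
            (φ (grassmannLaplacian ℂ C' (effAction ℂ (C t) V) -
              (1 / 2 : ℂ) • ∑ X, ∑ Y, C' X Y • (grassmannDeriv ℂ X (effAction ℂ (C t) V) * grassmannDeriv ℂ Y (effAction ℂ (C t) V)) +
              (constPart ℂ (grassmannLaplacian ℂ C' (effBoltzmann ℂ (C t) V)) / effPartitionFn ℂ (C t) V) • 1)) t := by
  intro Γ _ _ C C' t hC V hVe hZ φ
  obtain ⟨G₁, hG⟩ := exists_hasDerivAt_apply_effAction C C' t hC hVe hZ
  -- notation: partition function, Boltzmann factor, effective action along the path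
  set Z : ℝ → ℂ := fun s => effPartitionFn ℂ (C s) V with hZdef
  set B : ℝ → GrassmannAlgebra ℂ Γ := fun s => effBoltzmann ℂ (C s) V with hBdef
  set 𝒢 : ℝ → GrassmannAlgebra ℂ Γ := fun s => effAction ℂ (C s) V with h𝒢def
  set ΔB : GrassmannAlgebra ℂ Γ := grassmannLaplacian ℂ C' (B t) with hΔBdef
  set Z' : ℂ := constPart ℂ ΔB with hZ'def
  have hZd : HasDerivAt Z Z' t := hasDerivAt_effPartitionFn C C' t hC V
  have hBd : ∀ ψ : GrassmannAlgebra ℂ Γ →ₗ[ℂ] ℂ, HasDerivAt (fun s => ψ (B s)) (ψ ΔB) t :=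
    fun ψ => hasDerivAt_apply_effBoltzmann C C' t hC V ψ
  have hZt : Z t ≠ 0 := hZ
  have hev : ∀ᶠ s in nhds t, Z s ≠ 0 := hZd.continuousAt.eventually_ne hZt
  have hGe : 𝒢 t ∈ GrassmannAlgebra.evenOdd ℂ 0 := effAction_mem_evenOdd_zero (C t) hVe
  have hGn : IsNilpotent (𝒢 t) :=
    isNilpotent_of_constPart_eq_zero ℂ (constPart_effAction ℂ (C t) V (isUnit_iff_ne_zero.2 hZt))
  set E : GrassmannAlgebra ℂ Γ := grassmannExp (-𝒢 t) with hEdef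
  set N := Fintype.card Γ with hN
  -- weak derivative of the powers of `-𝒢`
  have hneg : ∀ ψ : GrassmannAlgebra ℂ Γ →ₗ[ℂ] ℂ, HasDerivAt (fun s => ψ (-𝒢 s)) (ψ (-G₁)) t := by
    intro ψ
    simpa only [map_neg, Pi.neg_def] using (hG ψ).neg
  have hcomm : Commute (-𝒢 t) (-G₁) := ((commute_of_mem_evenOdd_zero ℂ hGe G₁).neg_left).neg_right
  have hpow : ∀ (i : ℕ) (ψ : GrassmannAlgebra ℂ Γ →ₗ[ℂ] ℂ),
      HasDerivAt (fun s => ψ ((-𝒢 s) ^ i)) (ψ ((i : ℂ) • ((-𝒢 t) ^ (i - 1) * (-G₁)))) t := by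
    intro i ψ
    cases i with
    | zero =>
      simp only [pow_zero, Nat.cast_zero, zero_smul, map_zero]
      exact hasDerivAt_const t (ψ 1)
    | succ n =>
      simpa using hasDerivAt_apply_pow_of_commute (fun s => -𝒢 s) (-G₁) t hneg hcomm n ψ
  -- near `t` the exponential of `-𝒢 s` is a FIXED polynomial in `-𝒢 s`
  have hexp_poly : ∀ s, Z s ≠ 0 →
      grassmannExp (-𝒢 s) = ∑ i ∈ Finset.range (N + 2), ((i.factorial : ℚ)⁻¹) • (-𝒢 s) ^ i := by
    intro s hs
    have h0 : constPart ℂ (-𝒢 s) = 0 := by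
      rw [map_neg, neg_eq_zero]
      exact constPart_effAction ℂ (C s) V (isUnit_iff_ne_zero.2 hs)
    have hnil : (-𝒢 s) ^ (N + 2) = 0 := by
      rw [pow_succ, pow_card_succ_eq_zero_of_constPart_eq_zero ℂ h0, zero_mul]
    exact IsNilpotent.exp_eq_sum hnil
  have hE_poly : E = ∑ j ∈ Finset.range (N + 1), ((j.factorial : ℚ)⁻¹) • (-𝒢 t) ^ j := by
    have h0 : constPart ℂ (-𝒢 t) = 0 := by
      rw [map_neg, neg_eq_zero]
      exact constPart_effAction ℂ (C t) V (isUnit_iff_ne_zero.2 hZt)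
    exact IsNilpotent.exp_eq_sum (pow_card_succ_eq_zero_of_constPart_eq_zero ℂ h0)
  -- weak derivative of `s ↦ exp(-𝒢 s)`: `-(E * G₁)`
  have hEd : ∀ ψ : GrassmannAlgebra ℂ Γ →ₗ[ℂ] ℂ, HasDerivAt (fun s => ψ (grassmannExp (-𝒢 s))) (ψ (-(E * G₁))) t := by
    intro ψ
    have hrw : ∀ y : ℕ → GrassmannAlgebra ℂ Γ, ψ (∑ i ∈ Finset.range (N + 2), ((i.factorial : ℚ)⁻¹) • y i) =
        ∑ i ∈ Finset.range (N + 2), (((i.factorial : ℚ)⁻¹ : ℚ) : ℂ) * ψ (y i) := by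
      intro y
      rw [map_sum]
      refine Finset.sum_congr rfl fun i _ => ?_
      rw [LinearMap.map_smul_of_tower, ← Rat.cast_smul_eq_qsmul ℂ, smul_eq_mul]
    have hS : HasDerivAt (fun s => ψ (∑ i ∈ Finset.range (N + 2), ((i.factorial : ℚ)⁻¹) • (-𝒢 s) ^ i))
        (ψ (∑ i ∈ Finset.range (N + 2), ((i.factorial : ℚ)⁻¹) • ((i : ℂ) • ((-𝒢 t) ^ (i - 1) * (-G₁))))) t := by
      rw [show (fun s => ψ (∑ i ∈ Finset.range (N + 2), ((i.factorial : ℚ)⁻¹) • (-𝒢 s) ^ i)) =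
          fun s => ∑ i ∈ Finset.range (N + 2), (((i.factorial : ℚ)⁻¹ : ℚ) : ℂ) * ψ ((-𝒢 s) ^ i) from
        funext fun s => hrw fun i => (-𝒢 s) ^ i, hrw]
      exact HasDerivAt.fun_sum fun i _ => (hpow i ψ).const_mul _
    have hval : ∑ i ∈ Finset.range (N + 2), ((i.factorial : ℚ)⁻¹) • ((i : ℂ) • ((-𝒢 t) ^ (i - 1) * (-G₁))) =
        -(E * G₁) := by
      rw [Finset.sum_range_succ', Nat.cast_zero, zero_smul, smul_zero, add_zero, hE_poly, Finset.sum_mul,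
        ← Finset.sum_neg_distrib]
      refine Finset.sum_congr rfl fun j _ => ?_
      rw [Nat.add_sub_cancel, mul_neg, smul_neg, smul_neg, smul_mul_assoc, ← inv_factorial_succ_smul_succ_smul ℂ j]
    rw [hval] at hS
    exact hS.congr_of_eventuallyEq (hev.mono fun s hs => by simp only [hexp_poly s hs])
  -- weak derivative of `R s := Z s • exp(-𝒢 s)`
  have hRd : ∀ ψ : GrassmannAlgebra ℂ Γ →ₗ[ℂ] ℂ,
      HasDerivAt (fun s => ψ (Z s • grassmannExp (-𝒢 s))) (ψ (Z' • E - Z t • (E * G₁))) t := by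
    intro ψ
    have h := hZd.mul (hEd ψ)
    have hf : (fun s => ψ (Z s • grassmannExp (-𝒢 s))) = (Z * fun s => ψ (grassmannExp (-𝒢 s))) := by
      funext s
      rw [Pi.mul_apply, map_smul, smul_eq_mul]
    rw [hf]
    refine h.congr_deriv ?_
    rw [map_sub, map_smul, map_smul, map_neg, smul_eq_mul, smul_eq_mul]
    ring
  -- `B = R` near `t`, so the weak derivatives agree: `ΔB = Z' • E - Z t • (E * G₁)`
  have hI : ΔB = Z' • E - Z t • (E * G₁) := by
    refine eq_of_forall_linearMap_apply_eq _ _ fun ψ => ?_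
    have h1 : HasDerivAt (fun s => ψ (B s)) (ψ (Z' • E - Z t • (E * G₁))) t := by
      refine (hRd ψ).congr_of_eventuallyEq (hev.mono fun s hs => ?_)
      show ψ (B s) = ψ (Z s • grassmannExp (-𝒢 s))
      rw [show B s = Z s • grassmannExp (-𝒢 s) from
        effBoltzmann_eq_smul_grassmannExp ℂ (C s) V (isUnit_iff_ne_zero.2 hs)]
    exact (hBd ψ).unique h1
  -- the Laplacian of `B t = Z t • E` through the exponential lemma
  have hBt : B t = Z t • E := effBoltzmann_eq_smul_grassmannExp ℂ (C t) V (isUnit_iff_ne_zero.2 hZt)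
  have hΔE := grassmannLaplacian_grassmannExp_neg_of_mem_evenOdd_zero C' hGe hGn
  have hI2 : Z t • (E * (-grassmannLaplacian ℂ C' (𝒢 t) +
      (1 / 2 : ℂ) • ∑ X, ∑ Y, C' X Y • (grassmannDeriv ℂ X (𝒢 t) * grassmannDeriv ℂ Y (𝒢 t)))) =
      Z' • E - Z t • (E * G₁) := by
    rw [← hΔE, ← LinearMap.map_smul_of_tower, ← hBt]
    exact hI
  -- solve for `G₁`
  set Q : GrassmannAlgebra ℂ Γ := (1 / 2 : ℂ) • ∑ X, ∑ Y, C' X Y • (grassmannDeriv ℂ X (𝒢 t) * grassmannDeriv ℂ Y (𝒢 t))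
    with hQdef
  have h3 : Z t • (E * (-grassmannLaplacian ℂ C' (𝒢 t) + Q + G₁)) = Z' • E := by
    calc Z t • (E * (-grassmannLaplacian ℂ C' (𝒢 t) + Q + G₁))
        = Z t • (E * (-grassmannLaplacian ℂ C' (𝒢 t) + Q)) + Z t • (E * G₁) := by rw [mul_add, smul_add]
      _ = Z' • E - Z t • (E * G₁) + Z t • (E * G₁) := by rw [hI2]
      _ = Z' • E := sub_add_cancel _ _
  have hunit : grassmannExp (𝒢 t) * E = 1 := IsNilpotent.exp_mul_exp_neg_self hGn
  have h4 := congrArg (fun y => (Z t)⁻¹ • (grassmannExp (𝒢 t) * y)) h3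
  simp only [mul_smul_comm, ← mul_assoc, hunit, one_mul, smul_smul, inv_mul_cancel₀ hZt, one_smul] at h4
  have hG₁ : G₁ = grassmannLaplacian ℂ C' (𝒢 t) - Q + (Z' / Z t) • 1 := by
    calc G₁ = (-grassmannLaplacian ℂ C' (𝒢 t) + Q + G₁) + grassmannLaplacian ℂ C' (𝒢 t) - Q := by abel
      _ = ((Z t)⁻¹ * Z') • 1 + grassmannLaplacian ℂ C' (𝒢 t) - Q := by rw [h4]
      _ = grassmannLaplacian ℂ C' (𝒢 t) - Q + (Z' / Z t) • 1 := by rw [div_eq_inv_mul]; abel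
  rw [← hG₁]
  exact hG φ

/-! ### THE SEED FLOW EQUATION of the countertermed Hubbard torus -/

/-- **THE SEED FLOW EQUATION of the countertermed Hubbard torus**: for `β, Λ > 0` and `Z^K_{Λ,h} ≠ 0`, the seeded effective
action `h ↦ 𝒢^K_{Λ,h}` satisfies Polchinski's equation in the seed strength `h`, weakly, with `Ċ_h` the entrywise
`h`-derivative of the seeded CT covariance above scale `Λ`:
`∂_h 𝒢 = Δ_{Ċ_h} 𝒢 - ½ Σ_{X,Y} Ċ_h(X,Y) ∂_X𝒢 ∂_Y𝒢 + (Ż_h/Z_h) · 1` — every finite `L ≥ 1`, `M`, `U`, `μ`, frame `K`, scale `Λ`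
(the seed is a Gaussian parameter above the fermionic scale: S1/S2/S11 of line `seed-strength-flow`, now for the effective
action itself). [cite: Salmhofer1999, Prop. 4.3 (4.89)] -/
theorem seedFlow_hubbardEffectiveActionCT :
    ∀ (L M : ℕ) [NeZero L] (β U μ h : ℝ) (K : TrigPolyC4v) (Λ : ℝ), 0 < β → 0 < Λ →
      hubbardEffPartitionFnCT L M β U μ h K Λ ≠ 0 → ∀ φ : HubbardGrassmann L M →ₗ[ℂ] ℂ,
        HasDerivAt (fun h' : ℝ => φ (hubbardEffectiveActionCT L M β U μ h' K Λ))
          (φ (grassmannLaplacian ℂ (Matrix.of fun X Y : HubbardFieldIdx L M => deriv (fun h' : ℝ => hubbardCovAboveCT L M β μ h' K Λ X Y) h)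
                (hubbardEffectiveActionCT L M β U μ h K Λ) -
              (1 / 2 : ℂ) • ∑ X, ∑ Y, deriv (fun h' : ℝ => hubbardCovAboveCT L M β μ h' K Λ X Y) h •
                (grassmannDeriv ℂ X (hubbardEffectiveActionCT L M β U μ h K Λ) *
                  grassmannDeriv ℂ Y (hubbardEffectiveActionCT L M β U μ h K Λ)) +
              (constPart ℂ (grassmannLaplacian ℂ
                  (Matrix.of fun X Y : HubbardFieldIdx L M => deriv (fun h' : ℝ => hubbardCovAboveCT L M β μ h' K Λ X Y) h)
                  (effBoltzmann ℂ (hubbardCovAboveCT L M β μ h K Λ) (hubbardInteractionCT L M β U K))) /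
                hubbardEffPartitionFnCT L M β U μ h K Λ) • 1)) h := by
  intro L M _ β U μ h K Λ hβ hΛ hZ φ
  have hC : ∀ X Y : HubbardFieldIdx L M, HasDerivAt (fun h' : ℝ => hubbardCovAboveCT L M β μ h' K Λ X Y)
      ((Matrix.of fun X Y : HubbardFieldIdx L M => deriv (fun h' : ℝ => hubbardCovAboveCT L M β μ h' K Λ X Y) h) X Y) h :=
    fun X Y => hasDerivAt_hubbardCovAboveCT_seed L M β μ h K Λ X Y hβ hΛ
  exact hasDerivAt_apply_effAction (fun h' : ℝ => hubbardCovAboveCT L M β μ h' K Λ) _ h hC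
    (hubbardInteractionCT_mem_evenOdd_zero L M β U K) hZ φ

end Summit.HubbardSuperconductivity.HubbardSuperconductivity.Theorems.AposterioriCapRgSeededBrokenRegimeBoseFermiPinned
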